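/-
Copyright: b2b-lace packet (literature seat, gen 15).  [FvdH17] §4.2 (4.16)–(4.17): DICTIONARY between the letters
of the instance `Letters.perc d p` (N76-L(a), `NoblePercLetters`) and the tree's real-valued repulsive diagrams WITH
their maxima — the bubble `repBubble` (`GeneralizedDisjointOccurrence`) and the square `repSquare`
(`RepulsiveSquareExtractionIndep`) — plus the pentagon product bound and the N68c slot bounds in the instance's
currency.  LEMMAS §25 leaf N76-L(b).  No named fact; no numeral; no dimension.
-/
import Literature.Probability.FitznerVanDerHofstad2017.NoblePercLetters
import Literature.Probability.FitznerVanDerHofstad2017.RepulsiveSquareExtractionIndep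
import Literature.Probability.FitznerVanDerHofstad2017.LabelledDisjointOccurrenceRelabel
import HarnessLib

/-!
# [FvdH17] §4.2 — `Letters.perc`: the bubble and square letters ARE `repBubble` / `repSquare`; pentagon ≤ τ⁵; slots

CITATION HEADER (PLACEMENT v2). This module is part of a certified REPRODUCTION of:
R. Fitzner, R. van der Hofstad, *Mean-field behavior for nearest-neighbor percolation in d > 10*,
Electron. J. Probab. 22 (2017), no. 43 [FvdH17], §4.2 Def. 4.1, (4.13)–(4.17) and the display after (4.18)
(arXiv:1506.07977v2 pp. 35–36 = EJP p. 33), with [NoBLE17] = PTRF 169 (2017), §5.3.2 (5.40), (5.42) p. 1098.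
Origin: build `lace` (host summit CriticalPhenomena), literature seat.

THE PRINTED OBJECTS.  (4.16) `𝓑_{j₁,j₂}(x₁,x₂) = max_{i=1,2} ℙ_p({0 ←j₁→ x₁}₁ ⊛ {x₁ ←j₂→ x₂}_i)`; (4.17) the
triangle with `max_{(i,j)}`; "The repulsive square … and pentagon … are defined in the same manner."  The tree
holds these maxima twice: as real numbers built member by member (`repBubble = max diagB diagBIndep` on
`ℙ_p ⊗ ℙ_p`; `repTriangle`, `repSquare` = `sup'` of the `ℙ_p^{⊗k}` members `diagTL`, `diagSL`), for which the
EXTRACTION bounds are proved (lit-g11–g14), and as the fields of the axiom-free bundle `Letters.perc d p`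
(`repLetter = (assignments n).sup …`, carver-g19), over which the blocks of App. B are typed (`NobleBlocks`).
`NoblePercLetters.perc_T_ge` identified the triangle; this module identifies the BUBBLE and the SQUARE, so that
every extraction/slot bound of the real-valued diagrams is available for the letters the blocks consume.

## What is proved
* `genDisjOcc_lineEvents₂_ge_01` / `piPerc_genDisjOcc_lineEvents₂_ge_01`: the `i = 2` member of (4.16) in the
  instance (`ℙ_p^{⊗2}` on `Fin 2 → _`, labels `![0,1]`) is the preimage of `genDisjConn₂` under
  `MeasurableEquiv.finTwoArrow`, and its probability is `ofReal diagBIndep` (`measurePreserving_finTwoArrow`).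
* `genDisjOcc_lineEvents₂_ge_00` / `piPerc_genDisjOcc_lineEvents₂_ge_00`: the `i = 1` member (labels `![0,0]`) is
  the cylinder over `{0 ←j₁→ x₁} ∘ {x₁ ←j₂→ x₂}` in the first coordinate ("if we choose i = 1 … the usual
  disjoint occurrence"), probability `ofReal diagB` (`Measure.pi_pi`).
* **`perc_B_ge`**: `(Letters.perc d p).B (ge m₁) (ge m₂) x₁ x₂ = ofReal (repBubble d p m₁ m₂ x₁ x₂)`.
* `piPerc_genDisjOcc_lineEvents₄_ge`, **`perc_S_ge`**: the square letter is `ofReal repSquare` (same `max`).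
* **`perc_P_le_prod`**: the pentagon letter is below `τ⁵` ((4.14)–(4.15), `repLetter_le_prod`).
* **`sum_perc_B_toReal_le_slots`, `sum_sum_perc_T_toReal_le_slots`, `sum3_perc_S_toReal_le_slots`**: the
  [NoBLE17] (5.40)–(5.42) slot bounds (`sum_repBubble_le_slots`, `sum_sum_repTriangle_le_slots`,
  `sum3_repSquare_le_slots`) restated for the instance's letters at at-least indices.

READING: as in `GeneralizedDisjointOccurrence` / `NoblePercLetters` — path reading of `{v ←m→ w}`, bond-disjoint
witnesses ([FvdH17] says "bond-disjoint" at eight places and "vertex disjoint" in Def. 4.1; HOME/GAPS lit-g15).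
Nothing in this module is a cited hypothesis.

## References
* [FvdH17] R. Fitzner, R. van der Hofstad, EJP 22 (2017) no. 43; arXiv:1506.07977v2 — §4.2 Def. 4.1, (4.13)–(4.17)
  (v2 pp. 35–36 = EJP p. 33).
* [NoBLE17] R. Fitzner, R. van der Hofstad, PTRF 169 (2017) 1041–1119 — §5.3.2 (5.40)–(5.42) p. 1098.
* [Gri99] G. Grimmett, Percolation, 2nd ed., Springer 1999 — §2.3 (BK).
-/

noncomputable section

namespace Literature.Probability.FitznerVanDerHofstad2017.NobleBlocks

open _root_.MeasureTheory Literature.Probability.LatticeModels Literature.Probability.Percolation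
open Literature.Barriers.CriticalPhenomena
open Literature.Probability.FitznerVanDerHofstad2017.NobleBlocks.LenIdx
open scoped BigOperators ENNReal

variable {d : ℕ} (p : unitInterval)

/-! ### A. The two members of the bubble (4.16) in the instance -/

/-- The lines of (4.16) with labels `![0,1]` (second line on an INDEPENDENT configuration), as an event on
`Fin 2 → BondConfig`, is the preimage of the pair event `genDisjConn₂` under `ω ↦ (ω 0, ω 1)`.
[cite: FitznerVanDerHofstad2017, §4.2 Def. 4.1, (4.16) (arXiv:1506.07977v2 pp. 35–36)] -/
theorem genDisjOcc_lineEvents₂_ge_01 (m₁ m₂ : ℕ) (x₁ x₂ : Site d) :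
    genDisjOcc (lineEvents₂ (ge m₁) (ge m₂) x₁ x₂) ![0, 1] =
      ⇑(MeasurableEquiv.finTwoArrow (α := BondConfig (Site d))) ⁻¹' genDisjConn₂ m₁ m₂ (0 : Site d) x₁ x₁ x₂ := by
  have hlines : genDisjConnN (![⟨m₁, 0, x₁, 0⟩, ⟨m₂, x₁, x₂, 1⟩] : Fin 2 → GDLine (Site d) 2) =
      genDisjOcc (lineEvents₂ (ge m₁) (ge m₂) x₁ x₂) ![0, 1] := by
    rw [genDisjConnN_eq_genDisjOcc]
    have hA : (fun i => ((![⟨m₁, 0, x₁, 0⟩, ⟨m₂, x₁, x₂, 1⟩] : Fin 2 → GDLine (Site d) 2) i).event) =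
        lineEvents₂ (ge m₁) (ge m₂) x₁ x₂ := by
      funext i; fin_cases i <;> rfl
    have hc : (fun i => ((![⟨m₁, 0, x₁, 0⟩, ⟨m₂, x₁, x₂, 1⟩] : Fin 2 → GDLine (Site d) 2) i).c) = ![0, 1] := by
      funext i; fin_cases i <;> rfl
    rw [hA, hc]
  ext ω
  have hω : (![ω 0, ω 1] : Fin 2 → BondConfig (Site d)) = ω := by
    funext i; fin_cases i <;> rfl
  rw [Set.mem_preimage]
  change _ ↔ (ω 0, ω 1) ∈ genDisjConn₂ m₁ m₂ (0 : Site d) x₁ x₁ x₂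
  rw [← mem_genDisjConnN_two_iff, hω, hlines]

/-- **The `i = 2` member of (4.16) in the instance is `ofReal 𝓑^{(2)}`**: `ℙ_p^{⊗2}` on `Fin 2 → _` transported to
`ℙ_p ⊗ ℙ_p` by `measurePreserving_finTwoArrow`. [cite: FitznerVanDerHofstad2017, §4.2 (4.16) (arXiv:1506.07977v2 p. 36)] -/
theorem piPerc_genDisjOcc_lineEvents₂_ge_01 (m₁ m₂ : ℕ) (x₁ x₂ : Site d) :
    piPerc d p 2 (genDisjOcc (lineEvents₂ (ge m₁) (ge m₂) x₁ x₂) ![0, 1]) =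
      ENNReal.ofReal (diagBIndep d p m₁ m₂ x₁ x₂) := by
  rw [diagBIndep, ofReal_measureReal (measure_ne_top _ _), genDisjOcc_lineEvents₂_ge_01,
    ← MeasurableEquiv.map_apply, piPerc, (measurePreserving_finTwoArrow _).map_eq]

/-- The lines of (4.16) with labels `![0,0]` (both on the first configuration) form the cylinder over the ordinary
disjoint occurrence `{0 ←m₁→ x₁} ∘ {x₁ ←m₂→ x₂}` in coordinate `0` ("if we choose i = 1 … the usual disjoint
occurrence"). [cite: FitznerVanDerHofstad2017, §4.2 Def. 4.1 and the remark after it, (4.16) (arXiv:1506.07977v2 pp. 35–36)] -/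
theorem genDisjOcc_lineEvents₂_ge_00 (m₁ m₂ : ℕ) (x₁ x₂ : Site d) :
    genDisjOcc (lineEvents₂ (ge m₁) (ge m₂) x₁ x₂) ![0, 0] =
      Set.pi Set.univ ![openConnGe m₁ (0 : Site d) x₁ □ openConnGe m₂ x₁ x₂, Set.univ] := by
  have h : (![0, 0] : Fin 2 → Fin 2) = (![0, 0] : Fin 2 → Fin 2) ∘ (![0, 1] : Fin 2 → Fin 2) := by
    funext i; fin_cases i <;> rfl
  rw [h, genDisjOcc_comp_eq_preimage, genDisjOcc_lineEvents₂_ge_01]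
  ext ω
  simp only [Set.mem_preimage, Set.mem_univ_pi, Fin.forall_fin_two, Matrix.cons_val_zero, Matrix.cons_val_one,
    Set.mem_univ, and_true]
  change ((ω ∘ ![0, 0]) 0, (ω ∘ ![0, 0]) 1) ∈ genDisjConn₂ m₁ m₂ (0 : Site d) x₁ x₁ x₂ ↔ _
  exact diag_mem_genDisjConn₂_iff m₁ m₂ 0 x₁ x₁ x₂ (ω 0)

/-- **The `i = 1` member of (4.16) in the instance is `ofReal 𝓑^{(1)}` = `ofReal diagB`** (`Measure.pi_pi`).
[cite: FitznerVanDerHofstad2017, §4.2 (4.16) (arXiv:1506.07977v2 p. 36)] -/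
theorem piPerc_genDisjOcc_lineEvents₂_ge_00 (m₁ m₂ : ℕ) (x₁ x₂ : Site d) :
    piPerc d p 2 (genDisjOcc (lineEvents₂ (ge m₁) (ge m₂) x₁ x₂) ![0, 0]) =
      ENNReal.ofReal (diagB d p m₁ m₂ x₁ x₂) := by
  rw [genDisjOcc_lineEvents₂_ge_00, piPerc, Measure.pi_pi, Fin.prod_univ_two]
  simp only [Matrix.cons_val_zero, Matrix.cons_val_one, measure_univ, mul_one]
  rw [diagB, diagBT, ENNReal.ofReal_toReal (measure_ne_top _ _)]

/-- **`𝓑_{m₁,m₂}(x₁,x₂)` of the instance is `ofReal (repBubble d p m₁ m₂ x₁ x₂)`** — the same maximum over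
`i = 1, 2`. [cite: FitznerVanDerHofstad2017, §4.2 (4.16) (arXiv:1506.07977v2 p. 36)] -/
theorem perc_B_ge (m₁ m₂ : ℕ) (x₁ x₂ : Site d) :
    (Letters.perc d p).B (ge m₁) (ge m₂) x₁ x₂ = ENNReal.ofReal (repBubble d p m₁ m₂ x₁ x₂) := by
  rw [repBubble, ENNReal.ofReal_max]
  apply le_antisymm
  · rw [perc_B, repLetter]
    refine Finset.sup_le fun c hc => ?_
    rw [mem_assignments_iff] at hc
    have hcv : c = ![0, c 1] := by
      funext i
      fin_cases i
      · exact hc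
      · rfl
    generalize hj : c 1 = j at hcv
    subst hcv
    fin_cases j
    · exact (piPerc_genDisjOcc_lineEvents₂_ge_00 p m₁ m₂ x₁ x₂).le.trans (le_max_left _ _)
    · exact (piPerc_genDisjOcc_lineEvents₂_ge_01 p m₁ m₂ x₁ x₂).le.trans (le_max_right _ _)
  · rw [perc_B]
    refine max_le ?_ ?_
    · rw [← piPerc_genDisjOcc_lineEvents₂_ge_00]
      exact piPerc_genDisjOcc_le_repLetter p _ (c := ![0, 0]) rfl
    · rw [← piPerc_genDisjOcc_lineEvents₂_ge_01]
      exact piPerc_genDisjOcc_le_repLetter p _ (c := ![0, 1]) rfl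

/-! ### B. The square -/

/-- The members of the repulsive square agree: `ℙ_p^{⊗4}(⊛ lines with assignment c)` of the instance is
`ofReal (diagSL d 4 p c …)` of `RepulsiveSquareExtractionIndep` (at-least indices).
[cite: FitznerVanDerHofstad2017, §4.2 (4.17) and the sentence after it (arXiv:1506.07977v2 p. 36)] -/
theorem piPerc_genDisjOcc_lineEvents₄_ge (c : Fin 4 → Fin 4) (m₁ m₂ m₃ m₄ : ℕ) (x₁ x₂ x₃ x₄ : Site d) :
    piPerc d p 4 (genDisjOcc (lineEvents₄ (ge m₁) (ge m₂) (ge m₃) (ge m₄) x₁ x₂ x₃ x₄) c) =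
      ENNReal.ofReal (diagSL d 4 p c m₁ m₂ m₃ m₄ x₁ x₂ x₃ x₄) := by
  rw [diagSL, genDisjConnN_eq_genDisjOcc]
  have hA : (fun i => (sqLines c m₁ m₂ m₃ m₄ x₁ x₂ x₃ x₄ i).event) =
      lineEvents₄ (ge m₁) (ge m₂) (ge m₃) (ge m₄) x₁ x₂ x₃ x₄ := by
    funext i
    fin_cases i <;> rfl
  have hc : (fun i => (sqLines c m₁ m₂ m₃ m₄ x₁ x₂ x₃ x₄ i).c) = c := by
    funext i
    fin_cases i <;> rfl
  rw [hA, hc, piPerc, ofReal_measureReal (measure_ne_top _ _)]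

/-- **`𝓢_{m₁,…,m₄}(x₁,…,x₄)` of the instance is `ofReal (repSquare d p m₁ m₂ m₃ m₄ x₁ x₂ x₃ x₄)`** — the same
maximum over `{1,…,4}³` ("defined in the same manner").
[cite: FitznerVanDerHofstad2017, §4.2 (4.17) and the sentence after it (arXiv:1506.07977v2 p. 36)] -/
theorem perc_S_ge (m₁ m₂ m₃ m₄ : ℕ) (x₁ x₂ x₃ x₄ : Site d) :
    (Letters.perc d p).S (ge m₁) (ge m₂) (ge m₃) (ge m₄) x₁ x₂ x₃ x₄ =
      ENNReal.ofReal (repSquare d p m₁ m₂ m₃ m₄ x₁ x₂ x₃ x₄) := by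
  rw [perc_S, repLetter, repSquare]
  apply le_antisymm
  · refine Finset.sup_le fun c hc => ?_
    rw [mem_assignments_iff] at hc
    have hcv : c = ![0, c 1, c 2, c 3] := by
      funext i
      fin_cases i
      · exact hc
      · rfl
      · rfl
      · rfl
    rw [piPerc_genDisjOcc_lineEvents₄_ge, hcv]
    refine ENNReal.ofReal_le_ofReal ?_
    exact Finset.le_sup'
      (f := fun ijl : Fin 4 × Fin 4 × Fin 4 => diagSL d 4 p ![0, ijl.1, ijl.2.1, ijl.2.2] m₁ m₂ m₃ m₄ x₁ x₂ x₃ x₄)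
      (Finset.mem_univ (c 1, c 2, c 3))
  · obtain ⟨ijl, -, hijl⟩ := Finset.exists_mem_eq_sup' (Finset.univ_nonempty (α := Fin 4 × Fin 4 × Fin 4))
      (fun ijl : Fin 4 × Fin 4 × Fin 4 => diagSL d 4 p ![0, ijl.1, ijl.2.1, ijl.2.2] m₁ m₂ m₃ m₄ x₁ x₂ x₃ x₄)
    rw [hijl, ← piPerc_genDisjOcc_lineEvents₄_ge]
    exact piPerc_genDisjOcc_le_repLetter p _ (c := ![0, ijl.1, ijl.2.1, ijl.2.2]) rfl

/-- `0 ≤ repSquare` (a maximum of probabilities). [folklore] -/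
theorem repSquare_nonneg (m₁ m₂ m₃ m₄ : ℕ) (x₁ x₂ x₃ x₄ : Site d) :
    0 ≤ repSquare d p m₁ m₂ m₃ m₄ x₁ x₂ x₃ x₄ :=
  (diagSL_nonneg (d := d) 4 p ![0, 0, 0, 0] m₁ m₂ m₃ m₄ x₁ x₂ x₃ x₄).trans
    (Finset.le_sup'
      (f := fun ijl : Fin 4 × Fin 4 × Fin 4 => diagSL d 4 p ![0, ijl.1, ijl.2.1, ijl.2.2] m₁ m₂ m₃ m₄ x₁ x₂ x₃ x₄)
      (Finset.mem_univ ((0 : Fin 4), (0 : Fin 4), (0 : Fin 4))))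

/-- `0 ≤ repTriangle` (a maximum of probabilities). [folklore] -/
theorem repTriangle_nonneg (m₁ m₂ m₃ : ℕ) (x₁ x₂ x₃ : Site d) : 0 ≤ repTriangle d p m₁ m₂ m₃ x₁ x₂ x₃ :=
  (diagTL_nonneg (d := d) 3 p ![0, 0, 0] m₁ m₂ m₃ x₁ x₂ x₃).trans
    (Finset.le_sup' (f := fun ij : Fin 3 × Fin 3 => diagTL d 3 p ![0, ij.1, ij.2] m₁ m₂ m₃ x₁ x₂ x₃)
      (Finset.mem_univ ((0 : Fin 3), (0 : Fin 3))))

/-! ### C. The pentagon: product bound (4.14)–(4.15) -/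

/-- **`𝓟_{j}(x₁,…,x₅) ≤ τ_{j₁}(x₁) τ_{j₂}(x₂−x₁) τ_{j₃}(x₃−x₂) τ_{j₄}(x₄−x₃) τ_{j₅}(x₅−x₄)`** — (4.14)–(4.15) for the
pentagon (the bundle has no `Pst` field, so the product is displayed; `repLetter_le_prod` + `Fin.prod_univ_five`).
[cite: FitznerVanDerHofstad2017, §4.2 (4.14)–(4.15) and the sentence after (4.17) (arXiv:1506.07977v2 pp. 35–36)] -/
theorem perc_P_le_prod (j₁ j₂ j₃ j₄ j₅ : LenIdx) (x₁ x₂ x₃ x₄ x₅ : Site d) :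
    (Letters.perc d p).P j₁ j₂ j₃ j₄ j₅ x₁ x₂ x₃ x₄ x₅ ≤
      (Letters.perc d p).tau j₁ x₁ * (Letters.perc d p).tau j₂ (x₂ - x₁) * (Letters.perc d p).tau j₃ (x₃ - x₂) *
        (Letters.perc d p).tau j₄ (x₄ - x₃) * (Letters.perc d p).tau j₅ (x₅ - x₄) := by
  classical
  rw [perc_P]
  refine (repLetter_le_prod p _ (fun i => by fin_cases i <;> exact isUpperSet_event _ _ _)
    (fun i => by fin_cases i <;> exact isFinitary_event _ _ _)).trans_eq ?_
  rw [Fin.prod_univ_five]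
  simp only [lineEvents₅, Matrix.cons_val_zero, Matrix.cons_val_one, Matrix.cons_val_two, Matrix.head_cons,
    Matrix.tail_cons, measure_event_eq_perc_tau, sub_zero]
  have h3 : (![event j₁ 0 x₁, event j₂ x₁ x₂, event j₃ x₂ x₃, event j₄ x₃ x₄, event j₅ x₄ x₅] :
      Fin 5 → Set (BondConfig (Site d))) 3 = event j₄ x₃ x₄ := rfl
  have h4 : (![event j₁ 0 x₁, event j₂ x₁ x₂, event j₃ x₂ x₃, event j₄ x₃ x₄, event j₅ x₄ x₅] :
      Fin 5 → Set (BondConfig (Site d))) 4 = event j₅ x₄ x₅ := rfl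
  simp only [h3, h4, measure_event_eq_perc_tau]

/-! ### D. The N68c slot bounds in the instance's currency -/

/-- **[NoBLE17] (5.40) at remainder slots for the instance's bubble letter** (`sum_repBubble_le_slots` through
`perc_B_ge`). [cite: FitznerVanDerHofstad2016NoBLE, §5.3.2 (5.40) PTRF p. 1098]
[cite: FitznerVanDerHofstad2017, §4.2 (4.16), (4.18) and the display after it (arXiv:1506.07977v2 p. 36)] -/
theorem sum_perc_B_toReal_le_slots (hd : 2 ≤ d) (hp : p < criticalProbI d) {m₁ m₂ M : ℕ} (hm : m₂ ≤ M)
    {x : Site d} {X : Set (Site d)} (hx : x ∈ X) {R₁ R₂ : ℝ} (hR₁ : IsRemKernelConst d [M] X R₁)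
    (hR₂ : IsRemKernelConst d [M - m₂, m₂] X R₂) (S : Finset (Site d)) :
    ∑ y ∈ S, ((Letters.perc d p).B (ge m₁) (ge m₂) y x).toReal ≤
      (∑ L ∈ Finset.Ico (m₁ + m₂) M,
          ((L + 1 - m₁ - m₂ : ℕ) : ℝ) * ((trailWordsTo d L x).card : ℝ) * (p : ℝ) ^ L) +
        ((M - m₁ - m₂ : ℕ) : ℝ) * ((p : ℝ) ^ M * (nobleSup2 d p * R₁)) +
          (p : ℝ) ^ M * (nobleSup2 d p ^ 2 * R₂) := by
  simp_rw [perc_B_ge, ENNReal.toReal_ofReal (repBubble_nonneg p _ _ _ _)]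
  exact sum_repBubble_le_slots hd p hp hm hx hR₁ hR₂ S

/-- **[NoBLE17] (5.41) at remainder slots for the instance's triangle letter** (`sum_sum_repTriangle_le_slots`
through `perc_T_ge`). [cite: FitznerVanDerHofstad2016NoBLE, §5.3.2 (5.41) PTRF p. 1098]
[cite: FitznerVanDerHofstad2017, §4.2 (4.17), (4.18) and the display after it (arXiv:1506.07977v2 p. 36)] -/
theorem sum_sum_perc_T_toReal_le_slots (hd : 2 ≤ d) (hp : p < criticalProbI d) {m₁ m₂ m₃ M : ℕ}
    (hm : m₂ + m₃ ≤ M) {x : Site d} {X : Set (Site d)} (hx : x ∈ X) {R₁ R₂ R₃ : ℝ}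
    (hR₁ : IsRemKernelConst d [M] X R₁) (hR₂ : IsRemKernelConst d [M - m₃, m₃] X R₂)
    (hR₃ : IsRemKernelConst d [M - (m₂ + m₃), m₂, m₃] X R₃) (S₁ S₂ : Finset (Site d)) :
    ∑ v ∈ S₁, ∑ y ∈ S₂, ((Letters.perc d p).T (ge m₁) (ge m₂) (ge m₃) v y x).toReal ≤
      (∑ L ∈ Finset.Ico (m₁ + m₂ + m₃) M,
          (((L + 2 - (m₁ + m₂ + m₃)).choose 2 : ℕ) : ℝ) * ((trailWordsTo d L x).card : ℝ) * (p : ℝ) ^ L) +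
        (((M + 1 - (m₁ + m₂ + m₃)).choose 2 : ℕ) : ℝ) * ((p : ℝ) ^ M * (nobleSup2 d p * R₁)) +
          ((M - (m₁ + m₂ + m₃) : ℕ) : ℝ) * ((p : ℝ) ^ M * (nobleSup2 d p ^ 2 * R₂)) +
            (p : ℝ) ^ M * (nobleSup2 d p ^ 3 * R₃) := by
  simp_rw [perc_T_ge, ENNReal.toReal_ofReal (repTriangle_nonneg p _ _ _ _ _ _)]
  exact sum_sum_repTriangle_le_slots hd p hp hm hx hR₁ hR₂ hR₃ S₁ S₂

/-- **[NoBLE17] (5.42) at remainder slots for the instance's square letter** (`sum3_repSquare_le_slots` through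
`perc_S_ge`). [cite: FitznerVanDerHofstad2016NoBLE, §5.3.2 (5.42) PTRF p. 1098]
[cite: FitznerVanDerHofstad2017, §4.2 (4.17) and the sentence after it, (4.18) and the display after it (arXiv:1506.07977v2 p. 36)] -/
theorem sum3_perc_S_toReal_le_slots (hd : 2 ≤ d) (hp : p < criticalProbI d) {m₁ m₂ m₃ m₄ M : ℕ}
    (hm : m₂ + m₃ + m₄ ≤ M) {x : Site d} {X : Set (Site d)} (hx : x ∈ X) {R₁ R₂ R₃ R₄ : ℝ}
    (hR₁ : IsRemKernelConst d [M] X R₁) (hR₂ : IsRemKernelConst d [M - m₄, m₄] X R₂)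
    (hR₃ : IsRemKernelConst d [M - (m₃ + m₄), m₃, m₄] X R₃)
    (hR₄ : IsRemKernelConst d [M - (m₂ + m₃ + m₄), m₂, m₃, m₄] X R₄) (S₁ S₂ S₃ : Finset (Site d)) :
    ∑ v ∈ S₁, ∑ y ∈ S₂, ∑ w ∈ S₃, ((Letters.perc d p).S (ge m₁) (ge m₂) (ge m₃) (ge m₄) v y w x).toReal ≤
      (∑ L ∈ Finset.Ico (m₁ + m₂ + m₃ + m₄) M,
          (((L + 3 - (m₁ + m₂ + m₃ + m₄)).choose 3 : ℕ) : ℝ) * ((trailWordsTo d L x).card : ℝ) * (p : ℝ) ^ L) +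
        (((M + 2 - (m₁ + m₂ + m₃ + m₄)).choose 3 : ℕ) : ℝ) * ((p : ℝ) ^ M * (nobleSup2 d p * R₁)) +
          (((M + 1 - (m₁ + m₂ + m₃ + m₄)).choose 2 : ℕ) : ℝ) * ((p : ℝ) ^ M * (nobleSup2 d p ^ 2 * R₂)) +
            ((M - (m₁ + m₂ + m₃ + m₄) : ℕ) : ℝ) * ((p : ℝ) ^ M * (nobleSup2 d p ^ 3 * R₃)) +
              (p : ℝ) ^ M * (nobleSup2 d p ^ 4 * R₄) := by
  simp_rw [perc_S_ge, ENNReal.toReal_ofReal (repSquare_nonneg p _ _ _ _ _ _ _ _)]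
  exact sum3_repSquare_le_slots hd p hp hm hx hR₁ hR₂ hR₃ hR₄ S₁ S₂ S₃

end Literature.Probability.FitznerVanDerHofstad2017.NobleBlocks
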